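/-
Copyright: the b2b-balaban cell (near-miss cell 7), T⁴-continuum fan-out, NE7b ROUND-2 swarm `t4-ne7b-formalise-*`
(seat leaf-07, gen 2), row S6f «window-drop steps in the zone calculus» of lineage t4-ne7b-p1's claim table
`LEAVES-NE7b.md` (R-OWNER-22-2 (U2)).  Part Ic: the level function FROM THE FLOW.
Released under the licence of the surrounding project.
-/
import Summits.QuantumFields.BalabanUV.T4Continuum.Support.HistoryLevels

/-!
# History levels, Ic: the model scale of a run is a level function — FROM (2.5), (2.7) and monotone couplings

Summits-side support leaf of the T⁴-continuum cell (rung (B)+1 on a FINITE torus only; NOT infinite volume, NOT the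
mass gap, NOT the Clay statement; NOT a proof of the spine estimate NE7b).  NE7b ROUND-2 swarm, row **S6f**: the count
with window-drop steps (`HistoryZonesDrops.card_admZSet_le_of_readingD`, `HistoryZonesDropsRegions.
card_admZSet_le_of_birthRegionsD`) asks for a LEVEL FUNCTION `LevelFn K lv`; `HistoryLevels.levelFn_levelOf` gives it for
the model scale `levelOf s K` from two facts about the window exponents `s` (`R_t = L^{s_t}`): stepwise non-increase on
`[0, K]` and drop control `B16SProfile.DropCtl s K`.  This file reads both off the FLOW of a run, in the vocabulary the
assembly displays (typer's `ACCEPT-A12I.md` §B2): (2.5) as `B14.IsRj L r (g t) (R t)` at every step, the interval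
`Step.InInterval γ K g` (`γ ≤ 1`), (2.7) as `B14.FlowIneq27 g β′ β₀ r K`, the located smallness
`(1 + g_n²β′(n−m))^{β₀} ≤ L^{⌊max(n−m,2)∕2⌋}` of `B16SProfile.dropCtl_of_27b`, and MONOTONE COUPLINGS `g_t ≤ g_{t+1}`
(from the sign `β ≥ 0` along the flow, `B14FlowStep.g_mono_of_betaNonneg` — the unprinted input the cell displays as
`BetaLowerH b`, `b ≥ 0`).  [folklore] bookkeeping; nothing is quoted from print beyond the cited predicates it consumes
BY NAME; nothing printed is asserted; no `[cite:]` tag; no `Prop` fact minted.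

WHAT.  §1 `expOf L R t := Nat.log L (R t)` — the window exponent of a size obeying (2.5) (`expOf_spec`: `R t = L^{expOf}`,
`(log g_t⁻²)^r ≤ R t`, minimality — the binder shape of `B16SProfile.dropCtl_of_27b` and of
`HistoryLevels.windowExp_succ_le`).  §2 `expOf_succ_le` (monotone couplings ⇒ non-increasing exponents), `dropCtl_expOf`
((2.7) + smallness ⇒ drop control), and **`levelFn_of_flow`**: the model scale `levelOf (expOf L R) K` of the run is a
`LevelFn K` — so the window-drop count applies to EVERY tuned run, with no sub-class display; variant
`levelFn_of_dropCtl` with `DropCtl` displayed (as `HistoryRealise` ∕ `HistoryAssemblyRealiseLE` display it).  §2b (v3): pointer —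
the clamped profile `clampExp` ∕ `flowProfile_of_flow` is in `Support/HistoryLevelsClamp.lean`.  §3 sanity.

HONEST DEPENDENCY (cell): continuum YM on T⁴ ⇐ BetaPertH ∧ nine spine estimates (0/9 proved); BetaPertH ⇐ (D1) ∧ (D4)
∧ CAP+tail; G-an2-4 gates asym, D1 and NE2/3/4.  This file changes none of it.  NE7b NOT proved.
-/

open Literature.MathematicalPhysics.QuantumFieldTheory.Balaban1983to89

namespace Summit.QuantumFields.BalabanUV.T4Continuum.HistoryZones

noncomputable section

/-! ## §1 The window exponent of a size obeying (2.5) -/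

/-- THE WINDOW EXPONENT `s_t` of the size `R_t = L^{s_t}` ((2.5) makes `R_t` a power of `L`). [folklore] -/
def expOf (L : ℕ) (R : ℕ → ℕ) (t : ℕ) : ℕ := Nat.log L (R t)

/-- **(2.5) READ AS EXPONENT DATA**: at every step `≤ K`, `R t = L^{expOf L R t}`, `(log g_t⁻²)^r ≤ R t`, and the
exponent is the least such — the binder shape of `B16SProfile.dropCtl_of_27b` ∕ `HistoryLevels.windowExp_succ_le`.
[folklore] -/
theorem expOf_spec {L : ℕ} (hL : 2 ≤ L) {r K : ℕ} {g : ℕ → ℝ} {R : ℕ → ℕ}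
    (hR : ∀ t, t ≤ K → B14.IsRj L r (g t) (R t)) :
    ∀ n, n ≤ K → R n = L ^ expOf L R n ∧ (Real.log ((g n) ^ 2)⁻¹) ^ r ≤ (R n : ℝ) ∧
      ∀ s' : ℕ, (Real.log ((g n) ^ 2)⁻¹) ^ r ≤ ((L ^ s' : ℕ) : ℝ) → expOf L R n ≤ s' := by
  intro n hn
  obtain ⟨s, hs, hle, hmin⟩ := hR n hn
  have he : expOf L R n = s := by
    rw [expOf, hs, Nat.log_pow (by omega)]
  refine ⟨by rw [he, hs], hle, fun s' h => by rw [he]; exact hmin s' h⟩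

/-! ## §2 The model scale of a run is a level function -/

/-- **NON-INCREASING EXPONENTS FROM MONOTONE COUPLINGS** (`0 < g_t ≤ g_{t+1} ≤ 1` along `[0, K]`). [folklore] -/
theorem expOf_succ_le {L : ℕ} (hL : 2 ≤ L) {r K : ℕ} {g : ℕ → ℝ} {R : ℕ → ℕ}
    (hR : ∀ t, t ≤ K → B14.IsRj L r (g t) (R t)) (hpos : ∀ n, n ≤ K → 0 < g n) (hle1 : ∀ n, n ≤ K → g n ≤ 1)
    (hmono : ∀ n, n < K → g n ≤ g (n + 1)) : ∀ t, t < K → expOf L R (t + 1) ≤ expOf L R t :=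
  windowExp_succ_le (expOf_spec hL hR) hpos hle1 hmono

/-- **DROP CONTROL OF THE EXPONENTS FROM THE FLOW** — `B16SProfile.dropCtl_of_27b` read on `expOf`: the interval
(`γ ≤ 1`), (2.5), (2.7) with exponent `r`, and the located smallness give `DropCtl (expOf L R) K`. [folklore] -/
theorem dropCtl_expOf {L : ℕ} (hL : 2 ≤ L) {r K : ℕ} {g : ℕ → ℝ} {γ β' β₀ : ℝ} {R : ℕ → ℕ}
    (hI : Step.InInterval γ K g) (hγ1 : γ ≤ 1) (hR : ∀ t, t ≤ K → B14.IsRj L r (g t) (R t))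
    (h27 : B14.FlowIneq27 g β' β₀ r K)
    (hΘ : ∀ m n, m < n → n ≤ K → (1 + (g n) ^ 2 * β' * ((n : ℝ) - m)) ^ β₀ ≤ (L : ℝ) ^ (max (n - m) 2 / 2)) :
    B16SProfile.DropCtl (expOf L R) K :=
  B16SProfile.dropCtl_of_27b (by omega) hI hγ1 R (expOf L R) (expOf_spec hL hR) h27 hΘ

/-- **THE MODEL SCALE OF A RUN IS A LEVEL FUNCTION — FROM THE FLOW.**  Along a run `g` in the interval `]0, γ]`,
`γ ≤ 1`, with monotone couplings, sizes `R` obeying (2.5) with exponent `r` at every step `≤ K`, (2.7) with exponent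
`r`, and the located smallness of the drop control: `LevelFn K (levelOf (expOf L R) K)` — the hypothesis of the
window-drop count, for every such run (no sub-class display). [folklore] -/
theorem levelFn_of_flow {L : ℕ} (hL : 2 ≤ L) {r K : ℕ} {g : ℕ → ℝ} {γ β' β₀ : ℝ} {R : ℕ → ℕ}
    (hI : Step.InInterval γ K g) (hγ1 : γ ≤ 1) (hmono : ∀ n, n < K → g n ≤ g (n + 1))
    (hR : ∀ t, t ≤ K → B14.IsRj L r (g t) (R t)) (h27 : B14.FlowIneq27 g β' β₀ r K)
    (hΘ : ∀ m n, m < n → n ≤ K → (1 + (g n) ^ 2 * β' * ((n : ℝ) - m)) ^ β₀ ≤ (L : ℝ) ^ (max (n - m) 2 / 2)) :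
    LevelFn K (levelOf (expOf L R) K) :=
  levelFn_levelOf
    (expOf_succ_le hL hR (fun n hn => (hI n hn).1) (fun n hn => (hI n hn).2.trans hγ1) hmono)
    (dropCtl_expOf hL hI hγ1 hR h27 hΘ)

/-- The same with the drop control DISPLAYED (as `HistoryRealise` ∕ `HistoryAssemblyRealiseLE` display it) and only
positivity, `g ≤ 1` and monotonicity of the couplings. [folklore] -/
theorem levelFn_of_dropCtl {L : ℕ} (hL : 2 ≤ L) {r K : ℕ} {g : ℕ → ℝ} {R : ℕ → ℕ}
    (hR : ∀ t, t ≤ K → B14.IsRj L r (g t) (R t)) (hpos : ∀ n, n ≤ K → 0 < g n) (hle1 : ∀ n, n ≤ K → g n ≤ 1)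
    (hmono : ∀ n, n < K → g n ≤ g (n + 1)) (hdrop : B16SProfile.DropCtl (expOf L R) K) :
    LevelFn K (levelOf (expOf L R) K) :=
  levelFn_levelOf (expOf_succ_le hL hR hpos hle1 hmono) hdrop

/-- the exponent recovers the size: `R t = L ^ expOf L R t` on `[0, K]` [folklore] -/
theorem pow_expOf_eq {L : ℕ} (hL : 2 ≤ L) {r K : ℕ} {g : ℕ → ℝ} {R : ℕ → ℕ}
    (hR : ∀ t, t ≤ K → B14.IsRj L r (g t) (R t)) {t : ℕ} (ht : t ≤ K) : R t = L ^ expOf L R t :=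
  (expOf_spec hL hR t ht).1

/-! ## §2b Pointer (v3): the clamped profile lives in `Support/HistoryLevelsClamp.lean` -/

/-- The exponent of a constant power profile is that power (`2 ≤ L`) — a one-line check of `expOf`; the CLAMPED
profile `clampExp`, `dropCtl_clampExp` and the per-cutoff package `flowProfile_of_flow` are in
`Support/HistoryLevelsClamp.lean` (p212094), NOT in this file. [folklore] -/
theorem expOf_const_pow {L : ℕ} (hL : 2 ≤ L) (e t : ℕ) : expOf L (fun _ => L ^ e) t = e := by
  rw [expOf, Nat.log_pow (by omega)]

/-! ## §3 Sanity (decided) -/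

namespace SanityLF

/-- sizes `27, 27, 9, 9, 3, 3` in base `L = 3`: exponents `3, 3, 2, 2, 1, 1` -/
example : (List.range 6).map (expOf 3 fun t => [27, 27, 9, 9, 3, 3].getD t 1) = [3, 3, 2, 2, 1, 1] := by decide

/-- … and the model scale of that run with cutoff `K = 5`: `2, 3, 3, 4, 4, 5` (two isolated window drops) -/
example : (List.range 6).map (levelOf (expOf 3 fun t => [27, 27, 9, 9, 3, 3].getD t 1) 5) = [2, 3, 3, 4, 4, 5] := by
  decide

end SanityLF

end

end Summit.QuantumFields.BalabanUV.T4Continuum.HistoryZones
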